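import Summits.PneNP.PneNP.Theorems.PermanentDescentPermanentNotInPStubPreimageFST
import Summits.PneNP.PneNP.Theorems.PermanentDescentPermanentNotInPStubGuardFST

/-!
# Route PermanentDescent, crux `PermanentNotInP` (stmt-PneNP-16143), line `Sketch` (xp-ladder) —
# the rungs are monotone in difficulty, and stub C in its "eventually" form

The precision ladder of the line `Sketch` is `PermLowBits k = {⟨s, bin i⟩ ∈ PermBits | i < k}` (the
crux's set-builder plus the guard `i < k`). The guard transducer `guardT k` of the landed stub B
(`Theorems/PermanentDescentPermanentNotInPStubGuardFST.lean`) copies its input when it parses with a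
tail `bin i`, `i < k`, and outputs `ε` otherwise; so for `k ≤ k'` it pulls the HIGHER rung `PermLowBits k'`
back to the LOWER rung `PermLowBits k` (`eval_guardT_mem_rung_iff`). With the landed stub A
(`stub_preimageFST`: a `DTIME(n^c)` language pulled back along a length-non-increasing finite-state
transduction is in `DTIME(n^(c+1))`) this gives:

* `stub_rungMonotone` (registered stub of the line): `k ≤ k' → PermLowBits k' ∈ DTIME(n^c) →
  PermLowBits k ∈ DTIME(n^(c+1))` — the fixed-precision exponents are non-decreasing up to `+1`;
* `unboundedPrecisionExponent_iff_eventually`: stub C of the skeleton,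
  `∀ c, ∃ k, PermLowBits k ∉ DTIME(n^c)`, is EQUIVALENT to its eventual form
  `∀ c, ∃ k₀, ∀ k ≥ k₀, PermLowBits k ∉ DTIME(n^c)` — once a rung leaves `DTIME(n^(c+1))`, every
  higher rung is outside `DTIME(n^c)`.

So the open core of the line is an honest statement about the TAIL of the ladder (every exponent
class is eventually left), not about a single rung. Lead prover-line-stmt-PneNP-16143-c1-0
(continuation c1), `--supports stmt-PneNP-16143`.
-/

set_option linter.dupNamespace false -- `Summit.PneNP.PneNP.…`: summit = sub-problem name (D-0017 single-conjunct layout)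

noncomputable section

namespace Summit.PneNP.PneNP.Theorems.XpLadder

open Literature.Computability.Complexity Computability

/-- **The guard of precision `k` pulls every higher rung back to rung `k`.** For `k ≤ k'`:
`(guardT k).eval w ∈ PermLowBits k' ↔ w ∈ PermLowBits k` (accepted inputs are copied and carry a tail
`bin i` with `i < k ≤ k'`; rejected inputs go to `ε`, which is no `boolPair`). [folklore] -/
theorem eval_guardT_mem_rung_iff {k k' : ℕ} (hkk : k ≤ k') (w : List Bool) :
    (guardT k).eval w ∈ ({w | ∃ (n : ℕ) (s : List Bool) (i : ℕ), i < k' ∧ s.length = n * n ∧ w = Literature.Computability.Complexity.boolPair s (Computability.encodeNat i) ∧ Nat.testBit (Matrix.permanent (Matrix.of fun a b : Fin n => if s.getD ((b : ℕ) + n * (a : ℕ)) false then (1 : ℕ) else 0)) i = true} : Language Bool) ↔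
      w ∈ ({w | ∃ (n : ℕ) (s : List Bool) (i : ℕ), i < k ∧ s.length = n * n ∧ w = Literature.Computability.Complexity.boolPair s (Computability.encodeNat i) ∧ Nat.testBit (Matrix.permanent (Matrix.of fun a b : Fin n => if s.getD ((b : ℕ) + n * (a : ℕ)) false then (1 : ℕ) else 0)) i = true} : Language Bool) := by
  simp only [Set.mem_setOf_eq, eval_eq]
  constructor
  · intro h
    by_cases hacc : accept k w = true
    · rw [if_pos hacc] at h
      obtain ⟨n, s, i, -, hs, hw, hbit⟩ := h
      refine ⟨n, s, i, ?_, hs, hw, hbit⟩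
      rw [hw, accept_boolPair, mem_tails] at hacc
      obtain ⟨j, hj, hji⟩ := hacc
      have : j = i := by simpa using congr_arg decodeNat hji
      omega
    · rw [if_neg hacc] at h
      obtain ⟨n, s, i, -, -, hw, -⟩ := h
      have := congr_arg List.length hw
      simp only [List.length_nil, length_boolPair] at this
      omega
  · rintro ⟨n, s, i, hik, hs, hw, hbit⟩
    have hacc : accept k w = true := by
      rw [hw, accept_boolPair, mem_tails]
      exact ⟨i, hik, rfl⟩
    rw [if_pos hacc]
    exact ⟨n, s, i, lt_of_lt_of_le hik hkk, hs, hw, hbit⟩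

/-- **Registered stub `stub_rungMonotone` of the line `Sketch`: the rungs are monotone in
difficulty.** For `k ≤ k'`, if the higher rung `PermLowBits k'` is in `DTIME(n^c)` then the lower
rung `PermLowBits k` is in `DTIME(n^(c+1))`: decide it by the guard transducer `guardT k` followed by
the decider of the higher rung (stub A `stub_preimageFST` with stub B's transducer). [folklore] -/
theorem stub_rungMonotone : ∀ (k k' c : ℕ), k ≤ k' → ({w | ∃ (n : ℕ) (s : List Bool) (i : ℕ), i < k' ∧ s.length = n * n ∧ w = Literature.Computability.Complexity.boolPair s (Computability.encodeNat i) ∧ Nat.testBit (Matrix.permanent (Matrix.of fun a b : Fin n => if s.getD ((b : ℕ) + n * (a : ℕ)) false then (1 : ℕ) else 0)) i = true} : Language Bool) ∈ Literature.Computability.Complexity.DTIME (fun n => n ^ c) → ({w | ∃ (n : ℕ) (s : List Bool) (i : ℕ), i < k ∧ s.length = n * n ∧ w = Literature.Computability.Complexity.boolPair s (Computability.encodeNat i) ∧ Nat.testBit (Matrix.permanent (Matrix.of fun a b : Fin n => if s.getD ((b : ℕ) + n * (a : ℕ)) false then (1 : ℕ) else 0)) i = true} : Language Bool) ∈ Literature.Computability.Complexity.DTIME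 (fun n => n ^ (c + 1)) := by
  intro k k' c hkk hV
  have hpre := stub_preimageFST (guardT k) (length_eval_le k) hV
  convert hpre using 1
  ext w
  exact (eval_guardT_mem_rung_iff hkk w).symm

/-- **Stub C is a statement about the tail of the ladder.** `UnboundedPrecisionExponent`
(`∀ c, ∃ k, PermLowBits k ∉ DTIME(n^c)`, the open core of the line) is equivalent to its eventual
form `∀ c, ∃ k₀, ∀ k ≥ k₀, PermLowBits k ∉ DTIME(n^c)`: a rung outside `DTIME(n^(c+1))` keeps every
higher rung outside `DTIME(n^c)` (`stub_rungMonotone`). [folklore] -/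
theorem unboundedPrecisionExponent_iff_eventually :
    (∀ c : ℕ, ∃ k : ℕ,
      ({w | ∃ (n : ℕ) (s : List Bool) (i : ℕ), i < k ∧ s.length = n * n ∧ w = Literature.Computability.Complexity.boolPair s (Computability.encodeNat i) ∧ Nat.testBit (Matrix.permanent (Matrix.of fun a b : Fin n => if s.getD ((b : ℕ) + n * (a : ℕ)) false then (1 : ℕ) else 0)) i = true} : Language Bool)
        ∉ Literature.Computability.Complexity.DTIME (fun n => n ^ c)) ↔
    (∀ c : ℕ, ∃ k₀ : ℕ, ∀ k : ℕ, k₀ ≤ k →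
      ({w | ∃ (n : ℕ) (s : List Bool) (i : ℕ), i < k ∧ s.length = n * n ∧ w = Literature.Computability.Complexity.boolPair s (Computability.encodeNat i) ∧ Nat.testBit (Matrix.permanent (Matrix.of fun a b : Fin n => if s.getD ((b : ℕ) + n * (a : ℕ)) false then (1 : ℕ) else 0)) i = true} : Language Bool)
        ∉ Literature.Computability.Complexity.DTIME (fun n => n ^ c)) := by
  constructor
  · intro hC c
    obtain ⟨k₀, hk₀⟩ := hC (c + 1)
    exact ⟨k₀, fun k hk hmem => hk₀ (stub_rungMonotone k₀ k c hk hmem)⟩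
  · intro h c
    obtain ⟨k₀, hk₀⟩ := h c
    exact ⟨k₀, hk₀ k₀ le_rfl⟩

end Summit.PneNP.PneNP.Theorems.XpLadder

end
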